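import Summits.KontsevichZagierPeriods.KontsevichZagierPeriods.Theorems.SoloInformedAlgCone
import Mathlib.Algebra.MvPolynomial.PDeriv
import Mathlib.Analysis.Analytic.Polynomial
import Mathlib.Analysis.Analytic.Linear
import Mathlib.Analysis.Calculus.FDeriv.Analytic
import Mathlib.Analysis.Calculus.Deriv.Prod
import Mathlib.Analysis.Calculus.Deriv.Comp
import Mathlib.Analysis.Calculus.Deriv.Mul
import Mathlib.Analysis.Calculus.Deriv.Add
import Mathlib.Topology.Algebra.Module.Equiv
import HarnessLib

/-!
# The DEN-calculus over `K`: polynomials of `K[x₀, x₁]` as analytic functions on `ℝ × ℝ`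

Solo programme `solo-KontsevichZagierPeriods-informed`, session s107, step (x-o) of the general
two-dimensional algorithm: the analysis needed for the termination measure of the vertex-germ
induction (maximal contact via the analytic implicit function).

* `soloInformedEvalR P : ℝ × ℝ → ℝ`, the evaluation of `P ∈ K[x₀, x₁]`; it is analytic;
* the derivative of `P` along a line is given by the partial derivatives `∂ᵢ P`
  (`soloInformed_hasDerivAt_aevalK_line`), whence the partial derivatives of `soloInformedEvalR P`
  and the entries of its Fréchet derivative; `∂₂` is invertible iff `∂₁ P ≠ 0` at the point;
* the values at `0` of `P` and `∂ᵢ P` as coefficients;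
* the values of a child germ in terms of the values of `F` (`(κx)^m child(x, w) = F(κx, κx(t+λw))`).

References: J. Kollár, *Lectures on Resolution of Singularities* (2007), §1.10.
-/

noncomputable section

open scoped BigOperators Topology
open Polynomial

namespace Summit.KontsevichZagierPeriods.KontsevichZagierPeriods.Theorems

variable {K : Type*} [Field K] [Algebra K ℝ]

/-! ### Evaluation as a function on `ℝ × ℝ` -/

/-- The polynomial `P ∈ K[x₀, x₁]` as a real function on `ℝ × ℝ`. [this work] -/
def soloInformedEvalR (P : MvPolynomial (Fin 2) K) : ℝ × ℝ → ℝ :=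
  fun p => MvPolynomial.aeval ![p.1, p.2] P

/-- Unfolding `soloInformedEvalR`. [this work] -/
theorem soloInformed_evalR_apply (P : MvPolynomial (Fin 2) K) (p : ℝ × ℝ) :
    soloInformedEvalR P p = MvPolynomial.aeval ![p.1, p.2] P := rfl

/-- `![0, 0] = 0`. [this work] -/
theorem soloInformed_vec_zero_zero : (![(0 : ℝ), 0] : Fin 2 → ℝ) = 0 := by
  funext j; fin_cases j <;> rfl

/-- The value at the origin is the constant coefficient. [this work] -/
theorem soloInformed_evalR_zero (P : MvPolynomial (Fin 2) K) :
    soloInformedEvalR P 0 = algebraMap K ℝ (MvPolynomial.coeff 0 P) := by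
  rw [soloInformed_evalR_apply, Prod.fst_zero, Prod.snd_zero, soloInformed_vec_zero_zero,
    soloInformed_aevalK_zero]

/-- The value of `∂ᵢ P` at the origin is the `xᵢ`-coefficient of `P`. [this work] -/
theorem soloInformed_evalR_pderiv_zero (P : MvPolynomial (Fin 2) K) (i : Fin 2) :
    soloInformedEvalR (MvPolynomial.pderiv i P) 0 =
      algebraMap K ℝ (MvPolynomial.coeff (Finsupp.single i 1) P) := by
  rw [soloInformed_evalR_zero, MvPolynomial.coeff_pderiv, zero_add, Finsupp.coe_zero, Pi.zero_apply,
    Nat.cast_zero, zero_add, mul_one]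

/-- **Polynomials are analytic.** [this work] -/
theorem soloInformed_analyticAt_evalR (P : MvPolynomial (Fin 2) K) (q : ℝ × ℝ) :
    AnalyticAt ℝ (soloInformedEvalR P) q := by
  unfold soloInformedEvalR
  refine AnalyticAt.aeval_mvPolynomial (fun i => ?_) P
  fin_cases i
  · exact analyticAt_fst
  · exact analyticAt_snd

/-! ### Derivatives -/

/-- **The derivative of a polynomial along a line** `s ↦ p + s v` is `∑ᵢ vᵢ ∂ᵢP`. [this work] -/
theorem soloInformed_hasDerivAt_aevalK_line (P : MvPolynomial (Fin 2) K) (p v : Fin 2 → ℝ) (t : ℝ) :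
    HasDerivAt (fun s : ℝ => (MvPolynomial.aeval (fun i => p i + s * v i) P : ℝ))
      (∑ i, v i * MvPolynomial.aeval (fun i => p i + t * v i) (MvPolynomial.pderiv i P)) t := by
  induction P using MvPolynomial.induction_on with
  | C a =>
    simp only [MvPolynomial.aeval_C, MvPolynomial.pderiv_C, map_zero, mul_zero,
      Finset.sum_const_zero]
    exact hasDerivAt_const t _
  | add p q hp hq =>
    simp only [map_add, mul_add, Finset.sum_add_distrib]
    exact hp.add hq
  | mul_X q n ih =>
    have hl : HasDerivAt (fun s : ℝ => p n + s * v n) (v n) t := by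
      simpa using ((hasDerivAt_id t).mul_const (v n)).const_add (p n)
    have h := ih.mul hl
    simp only [map_mul, MvPolynomial.aeval_X]
    refine h.congr_deriv ?_
    simp only [MvPolynomial.pderiv_mul, map_add, map_mul, MvPolynomial.aeval_X, Fin.sum_univ_two]
    fin_cases n
    · simp only [Fin.zero_eta, MvPolynomial.pderiv_X_self,
        MvPolynomial.pderiv_X_of_ne (zero_ne_one : (0 : Fin 2) ≠ 1), map_one, map_zero]
      ring
    · simp only [Fin.mk_one, MvPolynomial.pderiv_X_self,
        MvPolynomial.pderiv_X_of_ne (one_ne_zero : (1 : Fin 2) ≠ 0), map_one, map_zero]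
      ring

/-- The partial derivative in the first variable. [this work] -/
theorem soloInformed_hasDerivAt_evalR_fst (P : MvPolynomial (Fin 2) K) (x y : ℝ) :
    HasDerivAt (fun z => soloInformedEvalR P (z, y))
      (soloInformedEvalR (MvPolynomial.pderiv 0 P) (x, y)) x := by
  have h := soloInformed_hasDerivAt_aevalK_line P ![0, y] ![1, 0] x
  have hv : ∀ s : ℝ, (fun i => (![0, y] : Fin 2 → ℝ) i + s * (![1, 0] : Fin 2 → ℝ) i) = ![s, y] := by
    intro s; funext j; fin_cases j <;> simp
  simp only [hv, Fin.sum_univ_two, Matrix.cons_val_zero, Matrix.cons_val_one, one_mul,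
    zero_mul, add_zero] at h
  exact h

/-- The partial derivative in the second variable. [this work] -/
theorem soloInformed_hasDerivAt_evalR_snd (P : MvPolynomial (Fin 2) K) (x y : ℝ) :
    HasDerivAt (fun w => soloInformedEvalR P (x, w))
      (soloInformedEvalR (MvPolynomial.pderiv 1 P) (x, y)) y := by
  have h := soloInformed_hasDerivAt_aevalK_line P ![x, 0] ![0, 1] y
  have hv : ∀ s : ℝ, (fun i => (![x, 0] : Fin 2 → ℝ) i + s * (![0, 1] : Fin 2 → ℝ) i) = ![x, s] := by
    intro s; funext j; fin_cases j <;> simp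
  simp only [hv, Fin.sum_univ_two, Matrix.cons_val_zero, Matrix.cons_val_one, one_mul,
    zero_mul, zero_add] at h
  exact h

/-- **Entries of the Fréchet derivative** of a polynomial function. [this work] -/
theorem soloInformed_fderiv_evalR_apply (P : MvPolynomial (Fin 2) K) (q : ℝ × ℝ) (a b : ℝ) :
    fderiv ℝ (soloInformedEvalR P) q (a, b) =
      a * soloInformedEvalR (MvPolynomial.pderiv 0 P) q +
        b * soloInformedEvalR (MvPolynomial.pderiv 1 P) q := by
  have hF : HasFDerivAt (soloInformedEvalR P) (fderiv ℝ (soloInformedEvalR P) q) q :=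
    (soloInformed_analyticAt_evalR P q).differentiableAt.hasFDerivAt
  have h1 : fderiv ℝ (soloInformedEvalR P) q (1, 0) = soloInformedEvalR (MvPolynomial.pderiv 0 P) q := by
    have hpath : HasDerivAt (fun z : ℝ => (z, q.2)) ((1 : ℝ), (0 : ℝ)) q.1 :=
      (hasDerivAt_id q.1).prodMk (hasDerivAt_const q.1 q.2)
    have hc := hF.comp_hasDerivAt q.1 hpath
    exact hc.unique (soloInformed_hasDerivAt_evalR_fst P q.1 q.2)
  have h2 : fderiv ℝ (soloInformedEvalR P) q (0, 1) = soloInformedEvalR (MvPolynomial.pderiv 1 P) q := by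
    have hpath : HasDerivAt (fun w : ℝ => (q.1, w)) ((0 : ℝ), (1 : ℝ)) q.2 :=
      (hasDerivAt_const q.2 q.1).prodMk (hasDerivAt_id q.2)
    have hc := hF.comp_hasDerivAt q.2 hpath
    exact hc.unique (soloInformed_hasDerivAt_evalR_snd P q.1 q.2)
  have hab : ((a, b) : ℝ × ℝ) = a • ((1 : ℝ), (0 : ℝ)) + b • ((0 : ℝ), (1 : ℝ)) := by
    ext <;> simp
  rw [hab, map_add, map_smul, map_smul, h1, h2, smul_eq_mul, smul_eq_mul]

/-- `∂₂` of a polynomial function is invertible where `∂₁ P ≠ 0`. [this work] -/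
theorem soloInformed_isInvertible_fderiv_evalR_inr (P : MvPolynomial (Fin 2) K) (q : ℝ × ℝ)
    (h : soloInformedEvalR (MvPolynomial.pderiv 1 P) q ≠ 0) :
    (fderiv ℝ (soloInformedEvalR P) q ∘L ContinuousLinearMap.inr ℝ ℝ ℝ).IsInvertible := by
  set d := soloInformedEvalR (MvPolynomial.pderiv 1 P) q with hd
  have happ : ∀ w : ℝ, (fderiv ℝ (soloInformedEvalR P) q ∘L ContinuousLinearMap.inr ℝ ℝ ℝ) w =
      w * d := fun w => by
    rw [ContinuousLinearMap.comp_apply, ContinuousLinearMap.inr_apply,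
      soloInformed_fderiv_evalR_apply, zero_mul, zero_add]
  refine ContinuousLinearMap.IsInvertible.of_inverse (g := d⁻¹ • ContinuousLinearMap.id ℝ ℝ) ?_ ?_
  · ext
    simp only [ContinuousLinearMap.comp_apply, FunLike.coe_smul, Pi.smul_apply,
      ContinuousLinearMap.id_apply, happ, smul_eq_mul]
    field_simp
  · ext
    simp only [ContinuousLinearMap.comp_apply, FunLike.coe_smul, Pi.smul_apply,
      ContinuousLinearMap.id_apply, happ, smul_eq_mul]
    field_simp

/-- `∂₂` at the origin is invertible iff the `x₁`-coefficient is non-zero (the direction we use).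
[this work] -/
theorem soloInformed_isInvertible_fderiv_evalR_inr_zero (P : MvPolynomial (Fin 2) K)
    (h : MvPolynomial.coeff (Finsupp.single 1 1) P ≠ 0) :
    (fderiv ℝ (soloInformedEvalR P) 0 ∘L ContinuousLinearMap.inr ℝ ℝ ℝ).IsInvertible :=
  soloInformed_isInvertible_fderiv_evalR_inr P 0 (by
    rw [soloInformed_evalR_pderiv_zero]; exact (_root_.map_ne_zero _).2 h)

/-! ### Values of child germs -/

/-- **Values of a child germ in terms of `F`**: `(κx)^m · child_F(t, κ, λ)(x, w) = F(κx, κx(t + λw))`.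
[this work] -/
theorem soloInformed_pow_mul_evalR_childK (F : MvPolynomial (Fin 2) K) {m : ℕ}
    (hm : ∀ a ∈ F.support, m ≤ a 0 + a 1) (t κ lam : K) (x w : ℝ) :
    (algebraMap K ℝ κ * x) ^ m * soloInformedEvalR (soloInformedChildK F m t κ lam) (x, w) =
      soloInformedEvalR F (algebraMap K ℝ κ * x,
        algebraMap K ℝ κ * x * (algebraMap K ℝ t + algebraMap K ℝ lam * w)) := by
  rw [soloInformed_evalR_apply, soloInformed_evalR_apply, soloInformed_aeval_childK]
  have h := soloInformed_aeval_lowerChart_eq_pow_mul_blowLowK F hm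
    ![algebraMap K ℝ κ * x, algebraMap K ℝ t + algebraMap K ℝ lam * w]
  simp only [Matrix.cons_val_zero, Matrix.cons_val_one] at h ⊢
  exact h.symm

end Summit.KontsevichZagierPeriods.KontsevichZagierPeriods.Theorems
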